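import Summits.CriticalPhenomena.PercolationContinuityZ3.Theorems.PercNearOneGluingNoHeavyLowerTailKnQuestion8CoefficientwiseTrivialCoreClass
import HarnessLib

/-!
# THEOREM TC: conjecture GRAND holds on the trivial-core stratum of the conditioning vertex

Support file (`--supports stmt-CriticalPhenomena-4575`, closed), prover `prim-cplus-coupling` (gen 29).  No definitions, no named facts, no sorries;
standard axioms.  Memo `prim-cplus-coupling/A5-COUPLING-gen28.md` §2.6 and `A5-COUPLING-gen29.md`.  Parts 0–1: `…CoefficientwiseTrivialCoreFlip.lean`
(confinement, free-edge invariance, Harris on a product of cubes) and `…CoefficientwiseTrivialCoreClass.lean` (the classes `FL[s, J, A]`, their antipode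
and the grand-monotonicity of the cluster quadruple along a class); the component calculus is prim-lf-2's (THEOREM CC), used with root `z`.

Setting.  A finite multigraph `ends : ι → Sym2 V`, an edge set `E₀`, colourings `s ⊆ E₀` (red) / `E₀ \ s` (blue); `C_v(s) = openCluster (ends '' s) v`.
The cluster quadruple is `Q(s) = (C_x s, C_x(E₀∖s), C_z s, C_z(E₀∖s))`; `Q(E₀∖s)` is the swapped quadruple.  CONJECTURE GRAND (prim-cplus-coupling gen 28,
…CoefficientwiseGrandOneSided; the complete two-colouring shadow of van den Berg–Häggström–Kahn's Theorems 1.3/1.5 for two copies): on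
`S = {z ∉ C_x s} ∩ {z ∉ C_x(E₀∖s)}` ('no monochromatic `x–z` path') and for `F, G` monotone in the GRAND ORDER (`K ↑, L ↓, Z_R ↓, Z_B ↑`),
`0 ≤ Σ_S (F(Q s) − F(Q(E₀∖s)))·(G(Q s) − G(Q(E₀∖s)))`.  It contains SUPER, CROSS and the first rung CW-PA (= coefficientwise vdBHK 1.3); exact census by
this lane and by ttrl: 0 violations in ≈ 5·10¹⁰ closure problems (all graphs on ≤ 8 vertices, hypergraphs on ≤ 6, adversarial families to 16 vertices).

* `Coefficientwise.grand_trivialCore_class_nonneg` — on the trivial-core stratum (`C_z(s) ∩ C_z(E₀∖s) = {z}`, `x` outside the zone) the GRAND sum over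
  the class `{FL[s, J, A] : J ⊆ Comps, A ⊆ Fr}` of `s` is `≥ 0`: by `sdiff_flipFree` the swap acts on the class as the antipode `(J, A) ↦ (Comps∖J, Fr∖A)`,
  by `flipFree_mono` the summands are products of two functions monotone in (blue side of `z`, red free edges), so the class sum is a Harris sum on a
  product of two cubes (`harris_twoColouring_prod_twist`).
* `Coefficientwise.grand_trivialCore_nonneg` — **THEOREM TC**: `0 ≤ Σ_{s ⊆ E₀ : C_z(s) ∩ C_z(E₀∖s) = {z}, z ∉ C_x(s), z ∉ C_x(E₀∖s)} w(U) (F(Q s, U) − F(Q(E₀∖s), U))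
  (G(Q s, U) − G(Q(E₀∖s), U))` for every weight `w ≥ 0` of the zone `U = C_z(s) ∪ C_z(E₀∖s)` and grand-monotone test functions `F, G` that may depend
  on the zone — GRAND, hence SUPER, CROSS and CW-PA, hold on the stratum where the two clusters of the conditioning vertex meet only in `z`
  (spreading over classes as in prim-lf-2's `cc_sum_nonneg`; the `z`-side twin of THEOREM CC).  The complementary stratum is NOT signed
  (12,240 / 470,520 negative restricted sums at `n = 5`, memo gen 28 §3): all compensation happens through the bichromatic core of `z`.
[cite: KozmaNitzan2024, Questions 8–9 (§5.5 p. 36) (context: the Question-8 pocket covariance programme)]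
-/

namespace Summit.CriticalPhenomena.PercolationContinuityZ3.Theorems

open Finset Literature.Probability.Percolation
open scoped symmDiff

namespace Coefficientwise

variable {ι V : Type*} (ends : ι → Sym2 V) (E₀ : Finset ι) (x z : V) (Vf : Finset V)

set_option quotPrecheck false in
/-- red cluster of `z` -/
local notation "Cz[" s "]" => openCluster (ends '' (↑(s : Finset ι) : Set ι)) z
set_option quotPrecheck false in
/-- red cluster of `x` -/
local notation "Cx[" s "]" => openCluster (ends '' (↑(s : Finset ι) : Set ι)) x
set_option quotPrecheck false in
/-- the zone of `z`: `U = C_z(s) ∪ C_z(E₀ \ s)` -/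
local notation "U[" s "]" => (openCluster (ends '' (↑(s : Finset ι) : Set ι)) z ∪ openCluster (ends '' (↑(E₀ \ s : Finset ι) : Set ι)) z)
set_option quotPrecheck false in
/-- the component of `v` (root `z`) -/
local notation "Cmp[" s "," v "]" =>
  openCluster (ends '' (↑(E₀.filter (fun i => ∀ y ∈ ends i, y ∈ U[s] ∧ y ≠ z)) : Set ι)) v
set_option quotPrecheck false in
/-- the component of `v` as a finset -/
local notation "CmpF[" s "," v "]" => (Vf.filter (fun y : V => y ∈ Cmp[s, v]))
set_option quotPrecheck false in
/-- the finset of components of `U \ {z}` -/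
local notation "Comps[" s "]" => ((Vf.filter (fun v : V => v ∈ U[s] ∧ v ≠ z)).image (fun v : V => CmpF[s, v]))
set_option quotPrecheck false in
/-- the red-side components -/
local notation "RS[" s "]" => ((Comps[s]).filter (fun C : Finset V => (↑C : Set V) ⊆ Cz[s]))
set_option quotPrecheck false in
/-- the edges of `E₀` incident to a vertex set `W` -/
local notation "I[" W "]" => (@Finset.filter ι (fun i => ∃ w, w ∈ (W : Set V) ∧ w ∈ ends i) (fun _ => Classical.propDecidable _) E₀)
set_option quotPrecheck false in
/-- the free edges: those of `E₀` all of whose ends in the zone equal `z` -/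
local notation "Fr[" s "]" => (E₀.filter (fun i => ∀ w ∈ ends i, w ∈ U[s] → w = z))
set_option quotPrecheck false in
/-- the colouring with the components `J` flipped and the free edges `A` recoloured -/
local notation "FL[" s "," J "," A "]" => (((s : Finset ι) ∆ I[(↑((J : Finset (Finset V)).biUnion id) : Set V)]) ∆ (A : Finset ι))
set_option quotPrecheck false in
/-- trivial core: the two clusters of `z` meet only in `z` -/
local notation "TC[" s "]" => (∀ y, y ∈ Cz[s] → y ∈ Cz[E₀ \ s] → y = z)

open Classical in
/-- **The class sum of THEOREM TC.**  For `s ⊆ E₀` on the trivial-core stratum with `x` outside the zone of `z`, and `F₁, F₂` monotone in the grand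
order (`K ↑, L ↓, Z_R ↓, Z_B ↑`), the GRAND sum over the class of `s` is nonnegative. [cite: KozmaNitzan2024, Questions 8–9 (§5.5 p. 36) (context)] -/
theorem grand_trivialCore_class_nonneg (hVf : ∀ i ∈ E₀, ∀ y ∈ ends i, y ∈ Vf) {s : Finset ι} (hs : s ⊆ E₀) (hTC : TC[s]) (hxU : x ∉ U[s])
    (F₁ F₂ : Set V → Set V → Set V → Set V → ℝ)
    (m₁ : ∀ a a' b c d, a ⊆ a' → F₁ a b c d ≤ F₁ a' b c d) (n₁ : ∀ a b b' c d, b ⊆ b' → F₁ a b' c d ≤ F₁ a b c d)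
    (p₁ : ∀ a b c c' d, c ⊆ c' → F₁ a b c' d ≤ F₁ a b c d) (q₁ : ∀ a b c d d', d ⊆ d' → F₁ a b c d ≤ F₁ a b c d')
    (m₂ : ∀ a a' b c d, a ⊆ a' → F₂ a b c d ≤ F₂ a' b c d) (n₂ : ∀ a b b' c d, b ⊆ b' → F₂ a b' c d ≤ F₂ a b c d)
    (p₂ : ∀ a b c c' d, c ⊆ c' → F₂ a b c' d ≤ F₂ a b c d) (q₂ : ∀ a b c d d', d ⊆ d' → F₂ a b c d ≤ F₂ a b c d') :
    0 ≤ ∑ J ∈ (Comps[s]).powerset, ∑ A ∈ (Fr[s]).powerset,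
      (F₁ (Cx[FL[s, J, A]]) (Cx[E₀ \ FL[s, J, A]]) (Cz[FL[s, J, A]]) (Cz[E₀ \ FL[s, J, A]])
        - F₁ (Cx[E₀ \ FL[s, J, A]]) (Cx[FL[s, J, A]]) (Cz[E₀ \ FL[s, J, A]]) (Cz[FL[s, J, A]])) *
      (F₂ (Cx[FL[s, J, A]]) (Cx[E₀ \ FL[s, J, A]]) (Cz[FL[s, J, A]]) (Cz[E₀ \ FL[s, J, A]])
        - F₂ (Cx[E₀ \ FL[s, J, A]]) (Cx[FL[s, J, A]]) (Cz[E₀ \ FL[s, J, A]]) (Cz[FL[s, J, A]])) := by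
  obtain ⟨Φ, hΦ⟩ : ∃ Φ : Finset (Finset V) → Finset ι → ℝ,
      Φ = fun J A => F₁ (Cx[FL[s, J, A]]) (Cx[E₀ \ FL[s, J, A]]) (Cz[FL[s, J, A]]) (Cz[E₀ \ FL[s, J, A]]) := ⟨_, rfl⟩
  obtain ⟨Γ, hΓ⟩ : ∃ Γ : Finset (Finset V) → Finset ι → ℝ,
      Γ = fun J A => F₂ (Cx[FL[s, J, A]]) (Cx[E₀ \ FL[s, J, A]]) (Cz[FL[s, J, A]]) (Cz[E₀ \ FL[s, J, A]]) := ⟨_, rfl⟩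
  -- the antipode of the class is the colour swap
  have hanti : ∀ J ∈ (Comps[s]).powerset, ∀ A ∈ (Fr[s]).powerset,
      FL[s, Comps[s] \ J, Fr[s] \ A] = E₀ \ FL[s, J, A] ∧ E₀ \ (E₀ \ FL[s, J, A]) = FL[s, J, A] := by
    intro J hJ A hA
    rw [Finset.mem_powerset] at hJ hA
    have hcE := (flipFree_facts ends E₀ z Vf hVf hs hTC hJ hA).1
    exact ⟨(sdiff_flipFree ends E₀ z Vf hVf hs hJ hA).symm, Finset.sdiff_sdiff_eq_self hcE⟩
  have hsum : (∑ J ∈ (Comps[s]).powerset, ∑ A ∈ (Fr[s]).powerset,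
      (F₁ (Cx[FL[s, J, A]]) (Cx[E₀ \ FL[s, J, A]]) (Cz[FL[s, J, A]]) (Cz[E₀ \ FL[s, J, A]])
        - F₁ (Cx[E₀ \ FL[s, J, A]]) (Cx[FL[s, J, A]]) (Cz[E₀ \ FL[s, J, A]]) (Cz[FL[s, J, A]])) *
      (F₂ (Cx[FL[s, J, A]]) (Cx[E₀ \ FL[s, J, A]]) (Cz[FL[s, J, A]]) (Cz[E₀ \ FL[s, J, A]])
        - F₂ (Cx[E₀ \ FL[s, J, A]]) (Cx[FL[s, J, A]]) (Cz[E₀ \ FL[s, J, A]]) (Cz[FL[s, J, A]]))) =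
      ∑ J ∈ (Comps[s]).powerset, ∑ A ∈ (Fr[s]).powerset,
        (Φ J A - Φ (Comps[s] \ J) (Fr[s] \ A)) * (Γ J A - Γ (Comps[s] \ J) (Fr[s] \ A)) := by
    refine Finset.sum_congr rfl fun J hJ => Finset.sum_congr rfl fun A hA => ?_
    obtain ⟨h1, h2⟩ := hanti J hJ A hA
    simp only [hΦ, hΓ, h1, h2]
  rw [hsum]
  have hRS : RS[s] ⊆ Comps[s] := Finset.filter_subset _ _
  -- monotonicity in the twisted coordinates (blue side of `z`, red free edges)
  have mono : ∀ (F : Set V → Set V → Set V → Set V → ℝ),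
      (∀ a a' b c d, a ⊆ a' → F a b c d ≤ F a' b c d) → (∀ a b b' c d, b ⊆ b' → F a b' c d ≤ F a b c d) →
      (∀ a b c c' d, c ⊆ c' → F a b c' d ≤ F a b c d) → (∀ a b c d d', d ⊆ d' → F a b c d ≤ F a b c d') →
      ∀ B B' t t', B' ⊆ Comps[s] → t' ⊆ Fr[s] → B ⊆ B' → t ⊆ t' →
        F (Cx[FL[s, B ∆ (Comps[s] \ RS[s]), t ∆ (s ∩ Fr[s])]]) (Cx[E₀ \ FL[s, B ∆ (Comps[s] \ RS[s]), t ∆ (s ∩ Fr[s])]])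
          (Cz[FL[s, B ∆ (Comps[s] \ RS[s]), t ∆ (s ∩ Fr[s])]]) (Cz[E₀ \ FL[s, B ∆ (Comps[s] \ RS[s]), t ∆ (s ∩ Fr[s])]]) ≤
        F (Cx[FL[s, B' ∆ (Comps[s] \ RS[s]), t' ∆ (s ∩ Fr[s])]]) (Cx[E₀ \ FL[s, B' ∆ (Comps[s] \ RS[s]), t' ∆ (s ∩ Fr[s])]])
          (Cz[FL[s, B' ∆ (Comps[s] \ RS[s]), t' ∆ (s ∩ Fr[s])]]) (Cz[E₀ \ FL[s, B' ∆ (Comps[s] \ RS[s]), t' ∆ (s ∩ Fr[s])]]) := by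
    intro F mF nF pF qF B B' t t' hB' ht' hBB htt
    have hB : B ⊆ Comps[s] := hBB.trans hB'
    have ht : t ⊆ Fr[s] := htt.trans ht'
    have subJ : ∀ B₀, B₀ ⊆ Comps[s] → B₀ ∆ (Comps[s] \ RS[s]) ⊆ Comps[s] := fun B₀ hB₀ C hC => by
      rcases Finset.mem_symmDiff.mp hC with ⟨h, -⟩ | ⟨h, -⟩
      · exact hB₀ h
      · exact (Finset.mem_sdiff.mp h).1
    have subA : ∀ t₀, t₀ ⊆ Fr[s] → t₀ ∆ (s ∩ Fr[s]) ⊆ Fr[s] := fun t₀ ht₀ i hi => by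
      rcases Finset.mem_symmDiff.mp hi with ⟨h, -⟩ | ⟨h, -⟩
      · exact ht₀ h
      · exact (Finset.mem_inter.mp h).2
    have hred : RS[s] ∆ (B' ∆ (Comps[s] \ RS[s])) ⊆ RS[s] ∆ (B ∆ (Comps[s] \ RS[s])) := by
      intro C hC
      have f1 : C ∈ RS[s] → C ∈ Comps[s] := fun h => hRS h
      have f2 : C ∈ B → C ∈ B' := fun h => hBB h
      have f3 : C ∈ B' → C ∈ Comps[s] := fun h => hB' h
      simp only [Finset.mem_symmDiff, Finset.mem_sdiff] at hC ⊢
      tauto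
    have hfr : (s ∩ Fr[s]) ∆ (t ∆ (s ∩ Fr[s])) ⊆ (s ∩ Fr[s]) ∆ (t' ∆ (s ∩ Fr[s])) := by
      rw [symmDiff_comm t, symmDiff_comm t', symmDiff_symmDiff_cancel_left, symmDiff_symmDiff_cancel_left]
      exact htt
    obtain ⟨h1, h2, h3, h4⟩ := flipFree_mono ends E₀ x z Vf hVf hs hTC hxU (subJ B hB) (subJ B' hB') (subA t ht) (subA t' ht') hred hfr
    exact (mF _ _ _ _ _ h1).trans ((nF _ _ _ _ _ h2).trans ((pF _ _ _ _ _ h3).trans (qF _ _ _ _ _ h4)))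
  refine harris_twoColouring_prod_twist (Comps[s]) (Fr[s]) (Comps[s] \ RS[s]) (s ∩ Fr[s]) Finset.sdiff_subset Finset.inter_subset_right Φ Γ ?_ ?_
  · intro B B' t t' hB' ht' hBB htt
    simp only [hΦ]
    exact mono F₁ m₁ n₁ p₁ q₁ B B' t t' hB' ht' hBB htt
  · intro B B' t t' hB' ht' hBB htt
    simp only [hΓ]
    exact mono F₂ m₂ n₂ p₂ q₂ B B' t t' hB' ht' hBB htt


open Classical in
/-- **THEOREM TC** (prim-cplus-coupling gen 28 §2.6 / gen 29).  Conjecture GRAND — hence SUPER, CROSS and the coefficientwise first rung CW-PA —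
holds on the stratum where the two clusters of the conditioning vertex `z` meet only in `z`: for every finite multigraph, every weight `w ≥ 0` of the
zone `U = C_z(s) ∪ C_z(E₀∖s)` and all test functions `F₁, F₂ (K, L, Z_R, Z_B, U)` monotone in the grand order (`K ↑, L ↓, Z_R ↓, Z_B ↑`),
`0 ≤ Σ_{s ⊆ E₀ : C_z s ∩ C_z(E₀∖s) = {z}, z ∉ C_x s, z ∉ C_x(E₀∖s)} w(U)·(F₁(Q s, U) − F₁(Q(E₀∖s), U))·(F₂(Q s, U) − F₂(Q(E₀∖s), U))`,
`Q s = (C_x s, C_x(E₀∖s), C_z s, C_z(E₀∖s))`. [cite: KozmaNitzan2024, Questions 8–9 (§5.5 p. 36) (context: the Question-8 pocket covariance programme)] -/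
theorem grand_trivialCore_nonneg (hVf : ∀ i ∈ E₀, ∀ y ∈ ends i, y ∈ Vf) (w : Set V → ℝ) (hw : ∀ U, 0 ≤ w U)
    (F₁ F₂ : Set V → Set V → Set V → Set V → Set V → ℝ)
    (m₁ : ∀ a a' b c d u, a ⊆ a' → F₁ a b c d u ≤ F₁ a' b c d u) (n₁ : ∀ a b b' c d u, b ⊆ b' → F₁ a b' c d u ≤ F₁ a b c d u)
    (p₁ : ∀ a b c c' d u, c ⊆ c' → F₁ a b c' d u ≤ F₁ a b c d u) (q₁ : ∀ a b c d d' u, d ⊆ d' → F₁ a b c d u ≤ F₁ a b c d' u)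
    (m₂ : ∀ a a' b c d u, a ⊆ a' → F₂ a b c d u ≤ F₂ a' b c d u) (n₂ : ∀ a b b' c d u, b ⊆ b' → F₂ a b' c d u ≤ F₂ a b c d u)
    (p₂ : ∀ a b c c' d u, c ⊆ c' → F₂ a b c' d u ≤ F₂ a b c d u) (q₂ : ∀ a b c d d' u, d ⊆ d' → F₂ a b c d u ≤ F₂ a b c d' u) :
    0 ≤ ∑ s ∈ E₀.powerset.filter (fun s => TC[s] ∧ z ∉ Cx[s] ∧ z ∉ Cx[E₀ \ s]),
      w (U[s]) * ((F₁ (Cx[s]) (Cx[E₀ \ s]) (Cz[s]) (Cz[E₀ \ s]) (U[s]) - F₁ (Cx[E₀ \ s]) (Cx[s]) (Cz[E₀ \ s]) (Cz[s]) (U[s])) *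
        (F₂ (Cx[s]) (Cx[E₀ \ s]) (Cz[s]) (Cz[E₀ \ s]) (U[s]) - F₂ (Cx[E₀ \ s]) (Cx[s]) (Cz[E₀ \ s]) (Cz[s]) (U[s]))) := by
  obtain ⟨P, hP⟩ : ∃ P : Finset (Finset ι), P = E₀.powerset.filter (fun s => TC[s] ∧ z ∉ Cx[s] ∧ z ∉ Cx[E₀ \ s]) := ⟨_, rfl⟩
  rw [← hP]
  have memP : ∀ {s}, s ∈ P ↔ s ⊆ E₀ ∧ TC[s] ∧ z ∉ Cx[s] ∧ z ∉ Cx[E₀ \ s] := fun {s} => by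
    rw [hP, Finset.mem_filter, Finset.mem_powerset]
  -- the unweighted summand as a function of the colouring
  obtain ⟨H, hH⟩ : ∃ H : Finset ι → ℝ, H = fun c =>
      (F₁ (Cx[c]) (Cx[E₀ \ c]) (Cz[c]) (Cz[E₀ \ c]) (U[c]) - F₁ (Cx[E₀ \ c]) (Cx[c]) (Cz[E₀ \ c]) (Cz[c]) (U[c])) *
      (F₂ (Cx[c]) (Cx[E₀ \ c]) (Cz[c]) (Cz[E₀ \ c]) (U[c]) - F₂ (Cx[E₀ \ c]) (Cx[c]) (Cz[E₀ \ c]) (Cz[c]) (U[c])) := ⟨_, rfl⟩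
  have hgoal : (∑ s ∈ P, w (U[s]) * ((F₁ (Cx[s]) (Cx[E₀ \ s]) (Cz[s]) (Cz[E₀ \ s]) (U[s]) - F₁ (Cx[E₀ \ s]) (Cx[s]) (Cz[E₀ \ s]) (Cz[s]) (U[s])) *
        (F₂ (Cx[s]) (Cx[E₀ \ s]) (Cz[s]) (Cz[E₀ \ s]) (U[s]) - F₂ (Cx[E₀ \ s]) (Cx[s]) (Cz[E₀ \ s]) (Cz[s]) (U[s])))) =
      ∑ s ∈ P, w (U[s]) * H s := Finset.sum_congr rfl (fun s _ => by rw [hH])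
  rw [hgoal]
  -- x is outside the zone on P
  have hxP : ∀ s ∈ P, x ∉ U[s] := by
    intro s hs hx
    obtain ⟨-, -, hz1, hz2⟩ := memP.mp hs
    rcases hx with h | h
    · exact hz1 ((mem_openCluster_comm ends s z x).mp h)
    · exact hz2 ((mem_openCluster_comm ends (E₀ \ s) z x).mp h)
  -- facts about the class members of `s ∈ P`
  have hflipP : ∀ s ∈ P, ∀ d ∈ (Comps[s]).powerset ×ˢ (Fr[s]).powerset,
      FL[s, d.1, d.2] ∈ P ∧ Comps[FL[s, d.1, d.2]] = Comps[s] ∧ Fr[FL[s, d.1, d.2]] = Fr[s] ∧ U[FL[s, d.1, d.2]] = U[s] := by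
    intro s hs d hd
    obtain ⟨hsE, hTC, hz1, hz2⟩ := memP.mp hs
    rw [Finset.mem_product, Finset.mem_powerset, Finset.mem_powerset] at hd
    obtain ⟨hcE, -, -, hU, hTCc, hComps, hFr, -, -⟩ := flipFree_facts ends E₀ z Vf hVf hsE hTC hd.1 hd.2
    have hxU : x ∉ U[FL[s, d.1, d.2]] := by rw [hU]; exact hxP s hs
    refine ⟨memP.mpr ⟨hcE, hTCc, ?_, ?_⟩, hComps, hFr, hU⟩
    · exact fun hz => hxU (Or.inl ((mem_openCluster_comm ends _ x z).mp hz))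
    · exact fun hz => hxU (Or.inr ((mem_openCluster_comm ends _ x z).mp hz))
  -- weights of the classes
  obtain ⟨h, hh⟩ : ∃ h : Finset ι → ℝ,
      h = fun s => w (U[s]) * (((2 : ℝ) ^ (Comps[s]).card * (2 : ℝ) ^ (Fr[s]).card))⁻¹ := ⟨_, rfl⟩
  have hh' : ∀ s ∈ P, ∀ d ∈ (Comps[s]).powerset ×ˢ (Fr[s]).powerset, h (FL[s, d.1, d.2]) = h s := by
    intro s hs d hd
    obtain ⟨-, hComps, hFr, hU⟩ := hflipP s hs d hd
    rw [hh]
    dsimp only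
    rw [hComps, hFr, hU]
  -- Step 1: spread each term over its class
  have hspread : ∑ s ∈ P, w (U[s]) * H s =
      ∑ d ∈ P.sigma (fun s => (Comps[s]).powerset ×ˢ (Fr[s]).powerset), h d.1 * H d.1 := by
    rw [Finset.sum_sigma]
    refine Finset.sum_congr rfl fun s _ => ?_
    dsimp only
    rw [Finset.sum_const, Finset.card_product, Finset.card_powerset, Finset.card_powerset, nsmul_eq_mul, hh]
    have h2 : ((2 : ℝ) ^ (Comps[s]).card * (2 : ℝ) ^ (Fr[s]).card) ≠ 0 := by positivity
    push_cast
    field_simp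
  -- Step 2: the involution `(s, (J, A)) ↦ (FL[s, J, A], (J, A))`
  have hFLFL : ∀ (s : Finset ι) (J : Finset (Finset V)) (A : Finset ι), FL[FL[s, J, A], J, A] = s := by
    intro s J A
    rw [symmDiff_right_comm (s ∆ I[(↑(J.biUnion id) : Set V)]) A, symmDiff_symmDiff_cancel_right, symmDiff_symmDiff_cancel_right]
  have hinv : ∑ d ∈ P.sigma (fun s => (Comps[s]).powerset ×ˢ (Fr[s]).powerset), h d.1 * H d.1 =
      ∑ d ∈ P.sigma (fun s => (Comps[s]).powerset ×ˢ (Fr[s]).powerset), h d.1 * H (FL[d.1, d.2.1, d.2.2]) := by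
    refine Finset.sum_nbij' (fun d => ⟨FL[d.1, d.2.1, d.2.2], d.2⟩) (fun d => ⟨FL[d.1, d.2.1, d.2.2], d.2⟩) ?_ ?_ ?_ ?_ ?_
    · rintro ⟨s, J, A⟩ hd
      rw [Finset.mem_sigma] at hd ⊢
      obtain ⟨hP1, hComps, hFr, -⟩ := hflipP s hd.1 (J, A) hd.2
      exact ⟨hP1, by rw [hComps, hFr]; exact hd.2⟩
    · rintro ⟨s, J, A⟩ hd
      rw [Finset.mem_sigma] at hd ⊢
      obtain ⟨hP1, hComps, hFr, -⟩ := hflipP s hd.1 (J, A) hd.2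
      exact ⟨hP1, by rw [hComps, hFr]; exact hd.2⟩
    · rintro ⟨s, J, A⟩ _
      dsimp only
      rw [hFLFL]
    · rintro ⟨s, J, A⟩ _
      dsimp only
      rw [hFLFL]
    · rintro ⟨s, J, A⟩ hd
      rw [Finset.mem_sigma] at hd
      dsimp only
      rw [hh' s hd.1 (J, A) hd.2, hFLFL]
  rw [hspread, hinv, Finset.sum_sigma]
  refine Finset.sum_nonneg fun s hs => ?_
  dsimp only
  rw [← Finset.mul_sum]
  obtain ⟨hsE, hTC, -, -⟩ := memP.mp hs
  have hxU := hxP s hs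
  refine mul_nonneg ?_ ?_
  · rw [hh]
    exact mul_nonneg (hw _) (inv_nonneg.mpr (by positivity))
  -- Step 3: the class sum, with the zone argument frozen at `U[s]`
  rw [Finset.sum_product]
  have hclass : ∀ J ∈ (Comps[s]).powerset, ∀ A ∈ (Fr[s]).powerset, H (FL[s, J, A]) =
      (F₁ (Cx[FL[s, J, A]]) (Cx[E₀ \ FL[s, J, A]]) (Cz[FL[s, J, A]]) (Cz[E₀ \ FL[s, J, A]]) (U[s])
        - F₁ (Cx[E₀ \ FL[s, J, A]]) (Cx[FL[s, J, A]]) (Cz[E₀ \ FL[s, J, A]]) (Cz[FL[s, J, A]]) (U[s])) *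
      (F₂ (Cx[FL[s, J, A]]) (Cx[E₀ \ FL[s, J, A]]) (Cz[FL[s, J, A]]) (Cz[E₀ \ FL[s, J, A]]) (U[s])
        - F₂ (Cx[E₀ \ FL[s, J, A]]) (Cx[FL[s, J, A]]) (Cz[E₀ \ FL[s, J, A]]) (Cz[FL[s, J, A]]) (U[s])) := by
    intro J hJ A hA
    obtain ⟨-, -, -, hU⟩ := hflipP s hs (J, A) (Finset.mem_product.mpr ⟨hJ, hA⟩)
    rw [hH]
    dsimp only
    rw [hU]
  rw [Finset.sum_congr rfl fun J hJ => Finset.sum_congr rfl fun A hA => hclass J hJ A hA]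
  exact grand_trivialCore_class_nonneg ends E₀ x z Vf hVf hsE hTC hxU (fun a b c d => F₁ a b c d (U[s])) (fun a b c d => F₂ a b c d (U[s]))
    (fun a a' b c d hle => m₁ a a' b c d _ hle) (fun a b b' c d hle => n₁ a b b' c d _ hle) (fun a b c c' d hle => p₁ a b c c' d _ hle)
    (fun a b c d d' hle => q₁ a b c d d' _ hle) (fun a a' b c d hle => m₂ a a' b c d _ hle) (fun a b b' c d hle => n₂ a b b' c d _ hle)
    (fun a b c c' d hle => p₂ a b c c' d _ hle) (fun a b c d d' hle => q₂ a b c d d' _ hle)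

end Coefficientwise

end Summit.CriticalPhenomena.PercolationContinuityZ3.Theorems
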